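import Literature.IUT.LogVolume.DistinguishedPrimesBoundGalois
import Literature.NumberTheory.NumberFields.RelativeDifferentExponentsTower
import Mathlib.NumberTheory.NumberField.Discriminant.Different
import HarnessLib

/-!
# [IUTchIV] Theorem 1.10, Step (iii), for REAL towers: (D0) ⟹ (D6) along `F_tpd ⊆ F ⊆ K`, and
# `log(𝔰^ℚ) ≤ 2·d_mod·(log(𝔡^{F_tpd}) + log(𝔣^{F_tpd})) + log(2·3·5·l)` from (D0)-type inputs

Mochizuki, *Inter-universal Teichmüller theory IV*, RIMS manuscript (Apr. 2020; = PRIMS **57** (2021)),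
Theorem 1.10, proof Step (iii), pp. 24–26 (kurims `paper:url-56bcb0f95768`, read on the page): for the tower
`F_mod ⊆ F_tpd ⊆ F ⊆ K`, "`𝕍(F)^dst ⊆ 𝕍(F)^non` for the set of "distinguished" nonarchimedean valuations `v ∈
𝕍(F)^non`, i.e., `v` that extend to a valuation `∈ 𝕍(K)^non` that ramifies over `ℚ`" (p. 24), "(D0) if `v ∈
𝕍(F_tpd)^non` does not divide `2·3·5·l` and, moreover, is not contained in `Supp(𝔮^{F_tpd}_ADiv)`, then the
extension `K/F_tpd` is unramified over `v`" (p. 24), hence (D5)/(D6) (p. 25): a distinguished `v_ℚ` with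
`p_{v_ℚ} ∤ 2·3·5·l` "lies in the image of `Supp(𝔮^{F_tpd}_ADiv + 𝔡^{F_tpd}_ADiv)`", and (p. 26)
"`log(𝔰^ℚ) ≤ 2·d_mod·(log(𝔡^{F_tpd}) + log(𝔣^{F_tpd})) + log(2·3·5·l)`".

Sequel of `DistinguishedPrimesBound(Galois).lean` (abc-iut-L5-t15 gen 2), whose `sum_log_distinguished_le_of_isGalois`
proves the last display for ACTUAL number fields `F_mod ⊆ F_tpd` taking (D6) as its hypothesis. THIS FILE
derives (D6) from the (D0)-TYPE inputs along the genuine three-field tower `F_tpd ⊆ F ⊆ K` — the same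
hypotheses `hKunr` / `hFunr` as `DifferentConductorTowerThreeField.lean` (`K/F` and `F/F_tpd` unramified at
the good places of residue characteristic `∤ 2·3·5·l`, which abc-iut-S-d1 proves for the theta tower) — so that
the field `sQ_le` of `Thm110Numerics.ProofData` becomes a theorem about the genuine data with no (D6)
hypothesis left:

* `ramified_place_descends` — **(D0) ⟹ (D5)**: a place `u` of `K` ramified over `ℚ` (`e(u|p) ≥ 2`) with
  residue characteristic `∉ P` lies over a BAD place of `F_tpd` or over a place of `F_tpd` RAMIFIED over `ℚ`
  (`e(u|p) = e(u|w)·e(w|w₀)·e(w₀|p)` with the first two factors `= 1` at good places, `hKunr`, `hFunr`);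
* `sum_log_distinguished_le_tower` — **Step (iii) for the genuine tower**: `F_tpd/F_mod` Galois, `S` the bad
  places of `F_mod`, `S₀` the places of `F_tpd` over `S`, `dst` any finite set of primes each of which divides
  `2·3·5·l` or lies under a place of `K` ramified over `ℚ` (the definition of `𝕍_ℚ^dst`):
  `Σ_{q ∈ dst} log q ≤ 2·[F_mod:ℚ]·(deg(𝔡^{F_tpd}_ADiv) + deg(𝔣^{F_tpd}_ADiv)) + log(2·3·5·l)`.

Classical algebraic number theory (Dedekind: `e − 1 ≤ ord 𝔡`; multiplicativity of `e`); nothing here takes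
a side on Cor. 3.12; the [IUTchIV] locators record what it instantiates.
-/

noncomputable section

namespace Literature.IUT.LogVolume

open NumberField IsDedekindDomain Finset
open Literature.NumberTheory.NumberFields (ramificationIdx_tower_rel ramificationIdx_int_eq_mul)
open scoped Classical

variable (F₀ F K : Type*) [Field F₀] [NumberField F₀] [Field F] [NumberField F] [Field K] [NumberField K]
  [Algebra F₀ F] [Algebra F K] [Algebra F₀ K] [IsScalarTower F₀ F K]

/-! ### (D0) ⟹ (D5): a ramified place of `K` of residue characteristic `∉ P` descends to a bad or ramified place of `F_tpd` -/

omit [NumberField K] in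
/-- **(D0) ⟹ (D5) along `F_tpd ⊆ F ⊆ K`.** Let `S₀` be the bad places of `F₀ = F_tpd` and `P` a set of rational
primes such that, at residue characteristics `∉ P`, `K/F` is unramified at the places not over `S₀` (`hKunr`) and
`F/F₀` is unramified at the places not over `S₀` (`hFunr`). Then a place `u` of `K` with `e(u|p) ≥ 2` and
`p ∉ P` lies over a place `w₀` of `F₀` which is either bad (`w₀ ∈ S₀`) or ramified over `ℚ` (`e(w₀|p) ≥ 2`) —
printed (D0): "if `v ∈ 𝕍(F_tpd)^non` does not divide `2·3·5·l` and, moreover, is not contained in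
`Supp(𝔮^{F_tpd}_ADiv)`, then the extension `K/F_tpd` is unramified over `v`", whence (D5) (p. 25).
[claim: Mochizuki2012, status: disputed] -/
theorem ramified_place_descends (S₀ : Finset (HeightOneSpectrum (𝓞 F₀))) (P : Finset ℕ)
    (hKunr : ∀ u : HeightOneSpectrum (𝓞 K), residueChar K u ∉ P → finBelow F₀ K u ∉ S₀ →
      u.asIdeal.ramificationIdx (𝓞 F) = 1)
    (hFunr : ∀ w : HeightOneSpectrum (𝓞 F), residueChar F w ∉ P → finBelow F₀ F w ∉ S₀ →
      w.asIdeal.ramificationIdx (𝓞 F₀) = 1)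
    (u : HeightOneSpectrum (𝓞 K)) (hram : 2 ≤ u.asIdeal.ramificationIdx ℤ) (hp : residueChar K u ∉ P) :
    finBelow F₀ K u ∈ S₀ ∨ 2 ≤ (finBelow F₀ K u).asIdeal.ramificationIdx ℤ := by
  by_cases hS : finBelow F₀ K u ∈ S₀
  · exact Or.inl hS
  · refine Or.inr ?_
    -- `e(u|p) = e(w₀|p)·e(u|𝓞F₀)` and `e(u|𝓞F₀) = e(w|𝓞F₀)·e(u|𝓞F) = 1·1`
    have h1 : u.asIdeal.ramificationIdx (𝓞 F) = 1 := hKunr u hp hS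
    have h2 : (u.asIdeal.under (𝓞 F)).ramificationIdx (𝓞 F₀) = 1 := by
      have hres : residueChar F (finBelow F K u) = residueChar K u := residueChar_finBelow (F := F) u
      have hbel : finBelow F₀ F (finBelow F K u) = finBelow F₀ K u :=
        HeightOneSpectrum.ext (Ideal.under_under (B := 𝓞 F) u.asIdeal)
      exact hFunr (finBelow F K u) (by rwa [hres]) (by rwa [hbel])
    have h3 : u.asIdeal.ramificationIdx (𝓞 F₀) = 1 := by
      rw [ramificationIdx_tower_rel F₀ F K u.asIdeal, h1, h2]
    have h4 : u.asIdeal.ramificationIdx ℤ = (u.asIdeal.under (𝓞 F₀)).ramificationIdx ℤ := by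
      rw [ramificationIdx_int_eq_mul F₀ K u.asIdeal, h3, mul_one]
    rw [h4] at hram
    exact hram

omit [NumberField K] in
/-- (D0) ⟹ (D5) with `P = {2,3,5,l}` phrased through divisibility of `2·3·5·l`, the form consumed by
`sum_log_distinguished_le_tower`. [claim: Mochizuki2012, status: disputed] -/
theorem ramified_place_descends_of_not_dvd {l : ℕ} (S₀ : Finset (HeightOneSpectrum (𝓞 F₀)))
    (hKunr : ∀ u : HeightOneSpectrum (𝓞 K), residueChar K u ∉ ({2, 3, 5, l} : Finset ℕ) →
      finBelow F₀ K u ∉ S₀ → u.asIdeal.ramificationIdx (𝓞 F) = 1)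
    (hFunr : ∀ w : HeightOneSpectrum (𝓞 F), residueChar F w ∉ ({2, 3, 5, l} : Finset ℕ) →
      finBelow F₀ F w ∉ S₀ → w.asIdeal.ramificationIdx (𝓞 F₀) = 1)
    (u : HeightOneSpectrum (𝓞 K)) (hram : 2 ≤ u.asIdeal.ramificationIdx ℤ)
    (hp : ¬ residueChar K u ∣ 2 * 3 * 5 * l) :
    finBelow F₀ K u ∈ S₀ ∨ 2 ≤ (finBelow F₀ K u).asIdeal.ramificationIdx ℤ := by
  refine ramified_place_descends F₀ F K S₀ {2, 3, 5, l} hKunr hFunr u hram fun hmem => hp ?_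
  simp only [Finset.mem_insert, Finset.mem_singleton] at hmem
  rcases hmem with h | h | h | h <;> rw [h]
  · exact ⟨3 * 5 * l, by ring⟩
  · exact ⟨2 * 5 * l, by ring⟩
  · exact ⟨2 * 3 * l, by ring⟩
  · exact ⟨2 * 3 * 5, by ring⟩

/-! ### Step (iii) for the genuine tower: `Σ_{q ∈ dst} log q ≤ 2·d_mod·(deg 𝔡^{F_tpd} + deg 𝔣^{F_tpd}) + log(2·3·5·l)` -/

section StepIII

variable (Fmod : Type*) [Field Fmod] [NumberField Fmod] [Algebra Fmod F₀]

omit [NumberField F] [NumberField K] [Algebra F₀ F] [Algebra F K] [IsScalarTower F₀ F K] in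
/-- **[IUTchIV] Thm. 1.10, Step (iii), for the genuine tower `F_mod ⊆ F_tpd ⊆ F ⊆ K`** (p. 26: "we conclude
that `log(𝔰^ℚ) ≤ 2·d_mod·(log(𝔡^{F_tpd}) + log(𝔣^{F_tpd})) + log(2·3·5·l)`"). Data: `F_tpd/F_mod` Galois
(`F_tpd = F_mod(E_{F_mod}[2])`); bad places `S` of `F_mod` (`𝕍^bad_mod`) and `S₀` the places of `F_tpd` over
them (`Supp(𝔮^{F_tpd}_ADiv)`); a finite set `dst` of primes each of which divides `2·3·5·l` or lies under a
place of `K` ramified over `ℚ` (i.e. `dst ⊆ 𝕍_ℚ^dst ∪ {p | 2·3·5·l}`, (D1)); and the (D0)⟹(D5) descent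
`hD0` (from `ramified_place_descends_of_not_dvd`). Then
`Σ_{q ∈ dst} log q ≤ 2·[F_mod:ℚ]·(deg(𝔡^{F_tpd}_ADiv) + deg(𝔣^{F_tpd}_ADiv)) + log(2·3·5·l)`, i.e. the field
`sQ_le` of `Thm110Numerics.ProofData` with `d_mod = [F_mod:ℚ]`, for actual number fields.
[claim: Mochizuki2012, status: disputed] -/
theorem sum_log_distinguished_le_tower [IsGalois Fmod F₀] (S : Finset (HeightOneSpectrum (𝓞 Fmod)))
    (S₀ : Finset (HeightOneSpectrum (𝓞 F₀))) (hS₀ : ∀ w₀, w₀ ∈ S₀ ↔ finBelow Fmod F₀ w₀ ∈ S)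
    {l : ℕ} (hl : 0 < l) (dst : Finset ℕ) (hdst : ∀ q ∈ dst, q.Prime)
    (hdstK : ∀ q ∈ dst, q ∣ 2 * 3 * 5 * l ∨
      ∃ u : HeightOneSpectrum (𝓞 K), residueChar K u = q ∧ 2 ≤ u.asIdeal.ramificationIdx ℤ)
    (hD0 : ∀ u : HeightOneSpectrum (𝓞 K), 2 ≤ u.asIdeal.ramificationIdx ℤ → ¬ residueChar K u ∣ 2 * 3 * 5 * l →
      finBelow F₀ K u ∈ S₀ ∨ 2 ≤ (finBelow F₀ K u).asIdeal.ramificationIdx ℤ) :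
    ∑ q ∈ dst, Real.log q ≤
      2 * Module.finrank ℚ Fmod * (ndeg F₀ (differentDivisor F₀) + ndeg F₀ (ADivisor.reduced S₀)) +
        Real.log (2 * 3 * 5 * (l : ℝ)) := by
  refine sum_log_distinguished_le_of_isGalois Fmod F₀ S S₀ hS₀ hl dst hdst fun q hq => ?_
  rcases hdstK q hq with h | ⟨u, huq, hram⟩
  · exact Or.inl h
  · by_cases hdiv : q ∣ 2 * 3 * 5 * l
    · exact Or.inl hdiv
    · refine Or.inr ⟨finBelow Fmod F₀ (finBelow F₀ K u), ?_, ?_⟩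
      · rw [residueChar_finBelow, residueChar_finBelow, huq]
      · rcases hD0 u hram (by rwa [huq]) with hbad | hram₀
        · exact Or.inl ((hS₀ _).mp hbad)
        · refine Or.inr ⟨finBelow F₀ K u, rfl, ?_⟩
          have := ramificationIdx_int_sub_one_le_multiplicity (finBelow F₀ K u)
          omega

omit [NumberField F] [NumberField K] [Algebra F₀ F] [Algebra F K] [IsScalarTower F₀ F K] in
/-- **Step (iii), three-way form of the distinguished-prime hypothesis**: as `sum_log_distinguished_le_tower`, with
each `q ∈ dst` dividing `2·3·5·l`, OR equal to the residue characteristic of a BAD place of `F_mod` (`v ∈ S`, i.e.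
`q` under `Supp(𝔮)` — (D2)), OR lying under a place of `K` ramified over `ℚ`.
[claim: Mochizuki2012, status: disputed] -/
theorem sum_log_distinguished_le_tower' [IsGalois Fmod F₀] (S : Finset (HeightOneSpectrum (𝓞 Fmod)))
    (S₀ : Finset (HeightOneSpectrum (𝓞 F₀))) (hS₀ : ∀ w₀, w₀ ∈ S₀ ↔ finBelow Fmod F₀ w₀ ∈ S)
    {l : ℕ} (hl : 0 < l) (dst : Finset ℕ) (hdst : ∀ q ∈ dst, q.Prime)
    (hdstK : ∀ q ∈ dst, q ∣ 2 * 3 * 5 * l ∨ (∃ v ∈ S, residueChar Fmod v = q) ∨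
      ∃ u : HeightOneSpectrum (𝓞 K), residueChar K u = q ∧ 2 ≤ u.asIdeal.ramificationIdx ℤ)
    (hD0 : ∀ u : HeightOneSpectrum (𝓞 K), 2 ≤ u.asIdeal.ramificationIdx ℤ → ¬ residueChar K u ∣ 2 * 3 * 5 * l →
      finBelow F₀ K u ∈ S₀ ∨ 2 ≤ (finBelow F₀ K u).asIdeal.ramificationIdx ℤ) :
    ∑ q ∈ dst, Real.log q ≤
      2 * Module.finrank ℚ Fmod * (ndeg F₀ (differentDivisor F₀) + ndeg F₀ (ADivisor.reduced S₀)) +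
        Real.log (2 * 3 * 5 * (l : ℝ)) := by
  refine sum_log_distinguished_le_of_isGalois Fmod F₀ S S₀ hS₀ hl dst hdst fun q hq => ?_
  rcases hdstK q hq with h | ⟨v, hvS, hvq⟩ | ⟨u, huq, hram⟩
  · exact Or.inl h
  · exact Or.inr ⟨v, hvq, Or.inl hvS⟩
  · by_cases hdiv : q ∣ 2 * 3 * 5 * l
    · exact Or.inl hdiv
    · refine Or.inr ⟨finBelow Fmod F₀ (finBelow F₀ K u), ?_, ?_⟩
      · rw [residueChar_finBelow, residueChar_finBelow, huq]
      · rcases hD0 u hram (by rwa [huq]) with hbad | hram₀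
        · exact Or.inl ((hS₀ _).mp hbad)
        · refine Or.inr ⟨finBelow F₀ K u, rfl, ?_⟩
          have := ramificationIdx_int_sub_one_le_multiplicity (finBelow F₀ K u)
          omega

end StepIII

/-! ### Primes dividing the discriminant are distinguished; the bound for `T(I) = primeFactors(2·d_K) ∪ p(𝕍^bad)` -/

section SupportPrimes

variable (Fmod : Type*) [Field Fmod] [NumberField Fmod] [Algebra Fmod F₀]

omit [Algebra F K] [Algebra F₀ K] [IsScalarTower F₀ F K] [NumberField F] [NumberField F₀] [Algebra F₀ F] in
/-- **A prime dividing the discriminant lies under a ramified place** (Dedekind; Mathlib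
`NumberField.not_dvd_discr_iff_isUnramifiedIn` + `Algebra.isUnramifiedIn_iff_forall_ramificationIdx_eq_one`):
`p ∣ d_K ⟹ ∃ u ∣ p, e(u|p) ≥ 2`. [cite: NeukirchANT1999, Ch. III (2.12)] -/
theorem exists_two_le_ramificationIdx_of_dvd_discr {p : ℕ} (hp : p.Prime) (hdvd : (p : ℤ) ∣ discr K) :
    ∃ u : HeightOneSpectrum (𝓞 K), residueChar K u = p ∧ 2 ≤ u.asIdeal.ramificationIdx ℤ := by
  have hp' : Prime (p : ℤ) := Nat.prime_iff_prime_int.mp hp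
  haveI : Fact p.Prime := ⟨hp⟩
  by_contra H
  push Not at H
  have hunr : Algebra.IsUnramifiedIn (𝓞 K) (Ideal.span {(p : ℤ)}) := by
    rw [Algebra.isUnramifiedIn_iff_forall_ramificationIdx_eq_one]
    intro P hP hPover
    have hpb : Ideal.span {(p : ℤ)} ≠ ⊥ := by simp [hp.ne_zero]
    have hPne : P ≠ ⊥ := Ideal.ne_bot_of_liesOver_of_ne_bot hpb P
    let u : HeightOneSpectrum (𝓞 K) := ⟨P, hP, hPne⟩
    have hres : residueChar K u = p := (mem_placesOver_iff_residueChar u).mp ((mem_placesOver_iff u).mpr hPover)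
    have h1 : P.ramificationIdx ℤ < 2 := H u hres
    have h2 : 1 ≤ P.ramificationIdx ℤ := Ideal.ramificationIdx_pos P ℤ
    omega
  exact (NumberField.not_dvd_discr_iff_isUnramifiedIn K (𝓞 K) hp').mpr hunr hdvd

omit [NumberField F] [Algebra F₀ F] [Algebra F K] [IsScalarTower F₀ F K] in
/-- **[IUTchIV] Thm. 1.10, Step (iii), for the genuine support `T(I) = primeFactors(2·d_K) ∪ {p_v : v ∈ 𝕍^bad_mod}`**
(the cell's `ThetaVolumeInput.supportPrimes`, abc-iut-S2): every such prime divides `2`, divides `d_K` (hence lies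
under a ramified place of `K`, (D1)), or lies under `Supp(𝔮)` ((D2)), so (D0) ⟹ (D5)/(D6) and
`Σ_{p ∈ T(I)} log p ≤ 2·[F_mod:ℚ]·(deg(𝔡^{F_tpd}_ADiv) + deg(𝔣^{F_tpd}_ADiv)) + log(2·3·5·l)` (p. 26) — the field
`sQ_le` of `Thm110Numerics.ProofData` for the genuine datum, given only the (D0)-descent `hD0`
(`ramified_place_descends_of_not_dvd` ∘ the genuine unramifiedness facts). [claim: Mochizuki2012, status: disputed] -/
theorem sum_log_supportPrimes_le_tower [IsGalois Fmod F₀] (S : Finset (HeightOneSpectrum (𝓞 Fmod)))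
    (S₀ : Finset (HeightOneSpectrum (𝓞 F₀))) (hS₀ : ∀ w₀, w₀ ∈ S₀ ↔ finBelow Fmod F₀ w₀ ∈ S)
    {l : ℕ} (hl : 0 < l)
    (hD0 : ∀ u : HeightOneSpectrum (𝓞 K), 2 ≤ u.asIdeal.ramificationIdx ℤ → ¬ residueChar K u ∣ 2 * 3 * 5 * l →
      finBelow F₀ K u ∈ S₀ ∨ 2 ≤ (finBelow F₀ K u).asIdeal.ramificationIdx ℤ) :
    ∑ q ∈ (2 * (discr K).natAbs).primeFactors ∪ S.image (residueChar Fmod), Real.log q ≤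
      2 * Module.finrank ℚ Fmod * (ndeg F₀ (differentDivisor F₀) + ndeg F₀ (ADivisor.reduced S₀)) +
        Real.log (2 * 3 * 5 * (l : ℝ)) := by
  classical
  refine sum_log_distinguished_le_tower' F₀ K Fmod S S₀ hS₀ hl _ (fun q hq => ?_) (fun q hq => ?_) hD0
  · rcases Finset.mem_union.mp hq with h | h
    · exact Nat.prime_of_mem_primeFactors h
    · obtain ⟨v, _, rfl⟩ := Finset.mem_image.mp h
      exact residueChar_prime Fmod v
  · rcases Finset.mem_union.mp hq with h | h
    · have hqp := Nat.prime_of_mem_primeFactors h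
      have hqd := Nat.dvd_of_mem_primeFactors h
      rcases (Nat.Prime.dvd_mul hqp).mp hqd with h2 | hd
      · refine Or.inl ?_
        rw [(Nat.prime_dvd_prime_iff_eq hqp Nat.prime_two).mp h2]
        exact ⟨3 * 5 * l, by ring⟩
      · exact Or.inr (Or.inr (exists_two_le_ramificationIdx_of_dvd_discr K hqp (Int.natCast_dvd.mpr hd)))
    · obtain ⟨v, hv, rfl⟩ := Finset.mem_image.mp h
      exact Or.inr (Or.inl ⟨v, hv, rfl⟩)

end SupportPrimes



end Literature.IUT.LogVolume

end
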